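import Summits.ValiantsHypothesis.ValiantsHypothesis.Theorems.LacunarySymmetroidMatrixDescartesFiniteSectorEtaThreeThree
import Summits.ValiantsHypothesis.ValiantsHypothesis.Theorems.LacunarySymmetroidMatrixDescartesFiniteSectorRealisableKThree

/-!
# `MatrixDescartes` — line «finite»: the SECTOR ceilings of the `K = 3` column BY NAME for `m = 4, 5`:
# `η(4,3) ≤ 20`, `η(5,3) ≤ 28` (`HypRootLawAt 4 3 20`, `HypRootLawAt 5 3 28`), hence `η(4,3) = 20`, `η(5,3) = 28` EXACT

HONEST FRAMING.  Object-search cell `pub-symmetroid`, seat val-sym-eng-3 g4 (desk pub-symmetroid R2504 (A): GO for `HypRootLawAt 4 3 20` /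
`5 3 28`).  HELPER of the crux item `stmt-ValiantsHypothesis-18050` (`Theses.LacunarySymmetroid.MatrixDescartes`, asymptotic in `K`) with
NO closure claim.  Same shape as `…FiniteSectorEtaThreeThree` (`hypRootLawAt_three_three_14`): the PROVED gap-rule SIEVE of line «finite»
(`…FiniteSector.sieve`, `natDegree_mem_sumset`) made uniform in the support — with three exponents the sieve at `r = 0` forces an exponent
`0`, the `m`-fold sums are `{q·x + s·y : q + s ≤ m}`, and a step-`≤ 2` chain from `{0,1}` to `n` inside them forces `n ≤ σ(m,3)`
(`σ(4,3) = 20`, `σ(5,3) = 28`, the card's certified gap-rule ceilings = `2·n(m,2)`), by a short generated case analysis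
(`min(x,y) ≤ 2` from `r = 1`; the second value bounded by the chain at `r = m·x + 1`; each live `(x,y)` dies at an explicit double gap;
`interval_cases` + `omega`, no `decide`).  Lower sides by name from the K = 3 column realisations (`fullyRealisable_four_013_ten`,
`fullyRealisable_five_014_fourteen`) doubled through door-p5 g7's adapter `not_hypRootLawAt_of_fullyRealisable`:
`η(4,3) = 20` and `η(5,3) = 28` are EXACT on both sides in the kernel.  Nothing here bears on the crux or on `VP ≠ VNP`.
[folklore] Elementary additive bookkeeping; no citation is load-bearing.
-/

-- `Summit.ValiantsHypothesis.ValiantsHypothesis.…` repeats a component by the D-0017 layout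
-- (single-conjunct summit), which the `dupNamespace` linter flags; the name is mandated.
set_option linter.dupNamespace false

namespace Summit.ValiantsHypothesis.ValiantsHypothesis.Theorems.LacunarySymmetroidMatrixDescartes.FiniteSector

open scoped BigOperators Matrix
open Polynomial

/-! ## §0 Two small tools (any number `m` of stamps) -/

/-- Symmetry of «`r = q·x + s·y` with `q + s ≤ m`» in `x, y`. [folklore] -/
theorem inS_comm' {m x y r : ℕ} (h : ∃ q s : ℕ, q + s ≤ m ∧ q * x + s * y = r) :
    ∃ q s : ℕ, q + s ≤ m ∧ q * y + s * x = r := by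
  obtain ⟨q, s, hqs, h⟩ := h
  exact ⟨s, q, by omega, by rw [← h]; ring⟩

/-- Second-value bound: if `G, G+1` are not among the sums `q·x` (`q ≤ m`) but the chain passes `G`, then `y ≤ G + 1`. [folklore] -/
theorem ybound {m x y n G : ℕ} (hG : G + 2 ≤ n)
    (hgap : ∀ q : ℕ, q ≤ m → q * x ≠ G ∧ q * x ≠ G + 1)
    (hc : (∃ q s : ℕ, q + s ≤ m ∧ q * x + s * y = G) ∨ (∃ q s : ℕ, q + s ≤ m ∧ q * x + s * y = G + 1)) :
    y ≤ G + 1 := by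
  have aux : ∀ t, (t = G ∨ t = G + 1) → (∃ q s : ℕ, q + s ≤ m ∧ q * x + s * y = t) → y ≤ G + 1 := by
    rintro t ht ⟨q, s, hqs, h⟩
    rcases Nat.eq_zero_or_pos s with hs | hs
    · subst hs
      have := hgap q (by omega)
      rcases ht with rfl | rfl <;> omega
    · have : y ≤ s * y := self_le_mul_of_one_le hs
      omega
  have := hG
  rcases hc with h | h
  · exact aux G (Or.inl rfl) h
  · exact aux (G + 1) (Or.inr rfl) h

/-! ## m = 4: a step-`≤ 2` chain in `{q·x + s·y : q + s ≤ 4}` stops by `20` -/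

-- explicit leaf-by-leaf case analysis (generated from the enumeration; every leaf closed by `omega`)
set_option maxHeartbeats 4000000 in
/-- Core case `1 ≤ x ≤ 2`, `1 ≤ y`: explicit double gaps. [folklore] -/
theorem chain43_core (x y n : ℕ) (hx1 : 1 ≤ x) (hx : x ≤ 2) (hy1 : 1 ≤ y) (hn : 21 ≤ n)
    (hmem : (∃ q s : ℕ, q + s ≤ 4 ∧ q * x + s * y = n))
    (hchain : (∀ r, r + 2 ≤ n → (∃ q s : ℕ, q + s ≤ 4 ∧ q * x + s * y = r) ∨ (∃ q s : ℕ, q + s ≤ 4 ∧ q * x + s * y = (r + 1)))) : False := by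
  obtain ⟨q0, s0, hqs0, hn0⟩ := hmem
  interval_cases x
  · -- x = 1: the chain at r = 5 forces y ≤ 6 (sums without y are ≤ 4)
    have hy : y ≤ 6 := by
      have h := ybound (m := 4) (n := n) (hG := by omega) (hgap := fun q hq => ⟨by omega, by omega⟩) (hc := hchain 5 (by omega))
      omega
    interval_cases y
    · omega -- y = 1: every sum ≤ 4 < 21
    · omega -- y = 2: every sum ≤ 8 < 21
    · omega -- y = 3: every sum ≤ 12 < 21
    · omega -- y = 4: every sum ≤ 16 < 21
    · omega -- y = 5: every sum ≤ 20 < 21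
    · -- y = 6: sums ≥ 21: [24]; double gap at 10, 11
      rcases hchain 10 (by omega) with ⟨q, s, hqs, h⟩ | ⟨q, s, hqs, h⟩
      · have hs' : s ≤ 4 := by omega
        interval_cases s <;> omega
      · have hs' : s ≤ 4 := by omega
        interval_cases s <;> omega
  · -- x = 2: the chain at r = 9 forces y ≤ 10 (sums without y are ≤ 8)
    have hy : y ≤ 10 := by
      have h := ybound (m := 4) (n := n) (hG := by omega) (hgap := fun q hq => ⟨by omega, by omega⟩) (hc := hchain 9 (by omega))
      omega
    interval_cases y
    · omega -- y = 1: every sum ≤ 8 < 21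
    · omega -- y = 2: every sum ≤ 8 < 21
    · omega -- y = 3: every sum ≤ 12 < 21
    · omega -- y = 4: every sum ≤ 16 < 21
    · omega -- y = 5: every sum ≤ 20 < 21
    · -- y = 6: sums ≥ 21: [24]; double gap at 21, 22
      rcases hchain 21 (by omega) with ⟨q, s, hqs, h⟩ | ⟨q, s, hqs, h⟩
      · have hs' : s ≤ 4 := by omega
        interval_cases s <;> omega
      · have hs' : s ≤ 4 := by omega
        interval_cases s <;> omega
    · -- y = 7: sums ≥ 21: [21, 23, 28]; double gap at 19, 20
      rcases hchain 19 (by omega) with ⟨q, s, hqs, h⟩ | ⟨q, s, hqs, h⟩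
      · have hs' : s ≤ 4 := by omega
        interval_cases s <;> omega
      · have hs' : s ≤ 4 := by omega
        interval_cases s <;> omega
    · -- y = 8: sums ≥ 21: [24, 26, 32]; double gap at 21, 22
      rcases hchain 21 (by omega) with ⟨q, s, hqs, h⟩ | ⟨q, s, hqs, h⟩
      · have hs' : s ≤ 4 := by omega
        interval_cases s <;> omega
      · have hs' : s ≤ 4 := by omega
        interval_cases s <;> omega
    · -- y = 9: sums ≥ 21: [22, 27, 29, 36]; double gap at 16, 17
      rcases hchain 16 (by omega) with ⟨q, s, hqs, h⟩ | ⟨q, s, hqs, h⟩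
      · have hs' : s ≤ 4 := by omega
        interval_cases s <;> omega
      · have hs' : s ≤ 4 := by omega
        interval_cases s <;> omega
    · -- y = 10: sums ≥ 21: [22, 24, 30, 32, 40]; double gap at 17, 18
      rcases hchain 17 (by omega) with ⟨q, s, hqs, h⟩ | ⟨q, s, hqs, h⟩
      · have hs' : s ≤ 4 := by omega
        interval_cases s <;> omega
      · have hs' : s ≤ 4 := by omega
        interval_cases s <;> omega

/-- **The `(4,3)` sieve bound.**  If `n ≥ 21` is a `4`-fold sum of `{0, x, y}` then the `4`-fold sums are NOT `2`-dense below
`n − 1`. [folklore] -/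
theorem chain43 (x y n : ℕ) (hn : 21 ≤ n) (hmem : (∃ q s : ℕ, q + s ≤ 4 ∧ q * x + s * y = n))
    (hchain : (∀ r, r + 2 ≤ n → (∃ q s : ℕ, q + s ≤ 4 ∧ q * x + s * y = r) ∨ (∃ q s : ℕ, q + s ≤ 4 ∧ q * x + s * y = (r + 1)))) : False := by
  -- a further value 0: one denomination `y`, the chain at r = 1 forces y ≤ 2 and n ≤ 8
  have one_denom : ∀ a b : ℕ, a = 0 → (∃ q s : ℕ, q + s ≤ 4 ∧ q * a + s * b = n) → (∀ r, r + 2 ≤ n → (∃ q s : ℕ, q + s ≤ 4 ∧ q * a + s * b = r) ∨ (∃ q s : ℕ, q + s ≤ 4 ∧ q * a + s * b = (r + 1))) → False := by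
    intro a b ha hm hch
    subst ha
    obtain ⟨q1, s1, hqs1, hn1⟩ := hm
    have hb : b ≤ 2 := by
      rcases hch 1 (by omega) with ⟨q, s, hqs, h⟩ | ⟨q, s, hqs, h⟩
      · rcases Nat.eq_zero_or_pos s with hs | hs
        · subst hs; omega
        · have := self_le_mul_of_one_le (b := b) hs; omega
      · rcases Nat.eq_zero_or_pos s with hs | hs
        · subst hs; omega
        · have := self_le_mul_of_one_le (b := b) hs; omega
    interval_cases b <;> omega
  rcases Nat.eq_zero_or_pos x with hx0 | hx1
  · exact one_denom x y hx0 hmem hchain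
  rcases Nat.eq_zero_or_pos y with hy0 | hy1
  · exact one_denom y x hy0 (inS_comm' hmem) (fun r hr => (hchain r hr).imp inS_comm' inS_comm')
  -- both ≥ 1: the chain at r = 1 forces min(x,y) ≤ 2
  rcases Nat.lt_or_ge x 3 with hx3 | hx3
  · exact chain43_core x y n hx1 (by omega) hy1 hn hmem hchain
  rcases Nat.lt_or_ge y 3 with hy3 | hy3
  · exact chain43_core y x n hy1 (by omega) hx1 hn (inS_comm' hmem) (fun r hr => (hchain r hr).imp inS_comm' inS_comm')
  have key : ∀ r, (∃ q s : ℕ, q + s ≤ 4 ∧ q * x + s * y = r) → r = 0 ∨ 3 ≤ r := by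
    rintro r ⟨q, s, hqs, h⟩
    rcases Nat.eq_zero_or_pos q with hq | hq
    · rcases Nat.eq_zero_or_pos s with hs | hs
      · subst hq; subst hs; left; omega
      · have := self_le_mul_of_one_le (b := y) hs; right; omega
    · have := self_le_mul_of_one_le (b := x) hq; right; omega
  rcases hchain 1 (by omega) with h | h
  · rcases key 1 h with h' | h' <;> omega
  · rcases key 2 h with h' | h' <;> omega

/-- **`η(4,3) ≤ 20 = σ(4,3)`** (`HypRootLawAt 4 3 20`): every real symmetric `4 × 4` lacunary pencil with `3` terms whose
determinant lies in the sector has determinant degree `≤ 20` — ALL supports `d : Fin 3 → ℕ`. [folklore] -/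
theorem hypRootLawAt_four_three_20 : HypRootLawAt 4 3 20 := by
  intro d S hS hsec
  by_contra hdeg'
  have hdeg : 20 < (pencil d S).det.natDegree := not_le.mp hdeg'
  have hq : (pencil d S).det ≠ 0 := by
    intro h0
    rw [h0] at hdeg
    simp at hdeg
  have himage : ∀ r, r ∈ (Finset.univ : Finset (Sym (Fin 3) 4)).image
      (fun s : Sym (Fin 3) 4 => ((s : Multiset (Fin 3)).map d).sum) →
      ∃ s : Multiset (Fin 3), Multiset.card s = 4 ∧ (s.map d).sum = r := by
    intro r hr
    rw [Finset.mem_image] at hr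
    obtain ⟨s, -, hs⟩ := hr
    exact ⟨(s : Multiset (Fin 3)), s.2, hs⟩
  have hsieve : ∀ r, r + 2 ≤ (pencil d S).det.natDegree →
      (∃ s : Multiset (Fin 3), Multiset.card s = 4 ∧ (s.map d).sum = r) ∨
      (∃ s : Multiset (Fin 3), Multiset.card s = 4 ∧ (s.map d).sum = r + 1) := by
    intro r hr
    rcases sieve d S hq hsec hr with h | h
    · exact Or.inl (himage r h)
    · exact Or.inr (himage (r + 1) h)
  have htop := himage _ (natDegree_mem_sumset d S hq)
  obtain ⟨a, ha⟩ : ∃ a, d a = 0 := by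
    rcases hsieve 0 (by omega) with ⟨s, hsc, hs⟩ | ⟨s, hsc, hs⟩
    · exact exists_eq_zero_of_sum_le_one d s (by omega) (by omega)
    · exact exists_eq_zero_of_sum_le_one d s (by omega) (by omega)
  obtain ⟨x, y, hxy⟩ := values_fin_three_zero d a ha
  have hIn : ∀ r, (∃ s : Multiset (Fin 3), Multiset.card s = 4 ∧ (s.map d).sum = r) →
      (∃ q s : ℕ, q + s ≤ 4 ∧ q * x + s * y = r) := by
    rintro r ⟨s, hsc, hs⟩
    obtain ⟨q, t, hqt, hsum⟩ := sum_eq_stamps_zero d x y hxy s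
    exact ⟨q, t, by omega, by omega⟩
  have hdeg2 : 21 ≤ (Matrix.det (∑ l, ((Polynomial.X : ℝ[X]) ^ d l) • (S l).map Polynomial.C)).natDegree := hdeg
  exact chain43 x y _ hdeg2 (hIn _ htop) (fun r hr => (hsieve r hr).imp (hIn r) (hIn (r + 1)))

/-! ## m = 5: a step-`≤ 2` chain in `{q·x + s·y : q + s ≤ 5}` stops by `28` -/

-- explicit leaf-by-leaf case analysis (generated from the enumeration; every leaf closed by `omega`)
set_option maxHeartbeats 4000000 in
/-- Core case `1 ≤ x ≤ 2`, `1 ≤ y`: explicit double gaps. [folklore] -/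
theorem chain53_core (x y n : ℕ) (hx1 : 1 ≤ x) (hx : x ≤ 2) (hy1 : 1 ≤ y) (hn : 29 ≤ n)
    (hmem : (∃ q s : ℕ, q + s ≤ 5 ∧ q * x + s * y = n))
    (hchain : (∀ r, r + 2 ≤ n → (∃ q s : ℕ, q + s ≤ 5 ∧ q * x + s * y = r) ∨ (∃ q s : ℕ, q + s ≤ 5 ∧ q * x + s * y = (r + 1)))) : False := by
  obtain ⟨q0, s0, hqs0, hn0⟩ := hmem
  interval_cases x
  · -- x = 1: the chain at r = 6 forces y ≤ 7 (sums without y are ≤ 5)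
    have hy : y ≤ 7 := by
      have h := ybound (m := 5) (n := n) (hG := by omega) (hgap := fun q hq => ⟨by omega, by omega⟩) (hc := hchain 6 (by omega))
      omega
    interval_cases y
    · omega -- y = 1: every sum ≤ 5 < 29
    · omega -- y = 2: every sum ≤ 10 < 29
    · omega -- y = 3: every sum ≤ 15 < 29
    · omega -- y = 4: every sum ≤ 20 < 29
    · omega -- y = 5: every sum ≤ 25 < 29
    · -- y = 6: sums ≥ 29: [30]; double gap at 16, 17
      rcases hchain 16 (by omega) with ⟨q, s, hqs, h⟩ | ⟨q, s, hqs, h⟩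
      · have hs' : s ≤ 5 := by omega
        interval_cases s <;> omega
      · have hs' : s ≤ 5 := by omega
        interval_cases s <;> omega
    · -- y = 7: sums ≥ 29: [29, 35]; double gap at 12, 13
      rcases hchain 12 (by omega) with ⟨q, s, hqs, h⟩ | ⟨q, s, hqs, h⟩
      · have hs' : s ≤ 5 := by omega
        interval_cases s <;> omega
      · have hs' : s ≤ 5 := by omega
        interval_cases s <;> omega
  · -- x = 2: the chain at r = 11 forces y ≤ 12 (sums without y are ≤ 10)
    have hy : y ≤ 12 := by
      have h := ybound (m := 5) (n := n) (hG := by omega) (hgap := fun q hq => ⟨by omega, by omega⟩) (hc := hchain 11 (by omega))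
      omega
    interval_cases y
    · omega -- y = 1: every sum ≤ 10 < 29
    · omega -- y = 2: every sum ≤ 10 < 29
    · omega -- y = 3: every sum ≤ 15 < 29
    · omega -- y = 4: every sum ≤ 20 < 29
    · omega -- y = 5: every sum ≤ 25 < 29
    · -- y = 6: sums ≥ 29: [30]; double gap at 27, 28
      rcases hchain 27 (by omega) with ⟨q, s, hqs, h⟩ | ⟨q, s, hqs, h⟩
      · have hs' : s ≤ 5 := by omega
        interval_cases s <;> omega
      · have hs' : s ≤ 5 := by omega
        interval_cases s <;> omega
    · -- y = 7: sums ≥ 29: [30, 35]; double gap at 26, 27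
      rcases hchain 26 (by omega) with ⟨q, s, hqs, h⟩ | ⟨q, s, hqs, h⟩
      · have hs' : s ≤ 5 := by omega
        interval_cases s <;> omega
      · have hs' : s ≤ 5 := by omega
        interval_cases s <;> omega
    · -- y = 8: sums ≥ 29: [32, 34, 40]; double gap at 29, 30
      rcases hchain 29 (by omega) with ⟨q, s, hqs, h⟩ | ⟨q, s, hqs, h⟩
      · have hs' : s ≤ 5 := by omega
        interval_cases s <;> omega
      · have hs' : s ≤ 5 := by omega
        interval_cases s <;> omega
    · -- y = 9: sums ≥ 29: [29, 31, 36, 38, 45]; double gap at 25, 26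
      rcases hchain 25 (by omega) with ⟨q, s, hqs, h⟩ | ⟨q, s, hqs, h⟩
      · have hs' : s ≤ 5 := by omega
        interval_cases s <;> omega
      · have hs' : s ≤ 5 := by omega
        interval_cases s <;> omega
    · -- y = 10: sums ≥ 29: [30, 32, 34, 40, 42, 50]; double gap at 27, 28
      rcases hchain 27 (by omega) with ⟨q, s, hqs, h⟩ | ⟨q, s, hqs, h⟩
      · have hs' : s ≤ 5 := by omega
        interval_cases s <;> omega
      · have hs' : s ≤ 5 := by omega
        interval_cases s <;> omega
    · -- y = 11: sums ≥ 29: [33, 35, 37, 44, 46, 55]; double gap at 20, 21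
      rcases hchain 20 (by omega) with ⟨q, s, hqs, h⟩ | ⟨q, s, hqs, h⟩
      · have hs' : s ≤ 5 := by omega
        interval_cases s <;> omega
      · have hs' : s ≤ 5 := by omega
        interval_cases s <;> omega
    · -- y = 12: sums ≥ 29: [30, 36, 38, 40, 48, 50, 60]; double gap at 21, 22
      rcases hchain 21 (by omega) with ⟨q, s, hqs, h⟩ | ⟨q, s, hqs, h⟩
      · have hs' : s ≤ 5 := by omega
        interval_cases s <;> omega
      · have hs' : s ≤ 5 := by omega
        interval_cases s <;> omega

/-- **The `(5,3)` sieve bound.**  If `n ≥ 29` is a `5`-fold sum of `{0, x, y}` then the `5`-fold sums are NOT `2`-dense below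
`n − 1`. [folklore] -/
theorem chain53 (x y n : ℕ) (hn : 29 ≤ n) (hmem : (∃ q s : ℕ, q + s ≤ 5 ∧ q * x + s * y = n))
    (hchain : (∀ r, r + 2 ≤ n → (∃ q s : ℕ, q + s ≤ 5 ∧ q * x + s * y = r) ∨ (∃ q s : ℕ, q + s ≤ 5 ∧ q * x + s * y = (r + 1)))) : False := by
  -- a further value 0: one denomination `y`, the chain at r = 1 forces y ≤ 2 and n ≤ 10
  have one_denom : ∀ a b : ℕ, a = 0 → (∃ q s : ℕ, q + s ≤ 5 ∧ q * a + s * b = n) → (∀ r, r + 2 ≤ n → (∃ q s : ℕ, q + s ≤ 5 ∧ q * a + s * b = r) ∨ (∃ q s : ℕ, q + s ≤ 5 ∧ q * a + s * b = (r + 1))) → False := by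
    intro a b ha hm hch
    subst ha
    obtain ⟨q1, s1, hqs1, hn1⟩ := hm
    have hb : b ≤ 2 := by
      rcases hch 1 (by omega) with ⟨q, s, hqs, h⟩ | ⟨q, s, hqs, h⟩
      · rcases Nat.eq_zero_or_pos s with hs | hs
        · subst hs; omega
        · have := self_le_mul_of_one_le (b := b) hs; omega
      · rcases Nat.eq_zero_or_pos s with hs | hs
        · subst hs; omega
        · have := self_le_mul_of_one_le (b := b) hs; omega
    interval_cases b <;> omega
  rcases Nat.eq_zero_or_pos x with hx0 | hx1
  · exact one_denom x y hx0 hmem hchain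
  rcases Nat.eq_zero_or_pos y with hy0 | hy1
  · exact one_denom y x hy0 (inS_comm' hmem) (fun r hr => (hchain r hr).imp inS_comm' inS_comm')
  -- both ≥ 1: the chain at r = 1 forces min(x,y) ≤ 2
  rcases Nat.lt_or_ge x 3 with hx3 | hx3
  · exact chain53_core x y n hx1 (by omega) hy1 hn hmem hchain
  rcases Nat.lt_or_ge y 3 with hy3 | hy3
  · exact chain53_core y x n hy1 (by omega) hx1 hn (inS_comm' hmem) (fun r hr => (hchain r hr).imp inS_comm' inS_comm')
  have key : ∀ r, (∃ q s : ℕ, q + s ≤ 5 ∧ q * x + s * y = r) → r = 0 ∨ 3 ≤ r := by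
    rintro r ⟨q, s, hqs, h⟩
    rcases Nat.eq_zero_or_pos q with hq | hq
    · rcases Nat.eq_zero_or_pos s with hs | hs
      · subst hq; subst hs; left; omega
      · have := self_le_mul_of_one_le (b := y) hs; right; omega
    · have := self_le_mul_of_one_le (b := x) hq; right; omega
  rcases hchain 1 (by omega) with h | h
  · rcases key 1 h with h' | h' <;> omega
  · rcases key 2 h with h' | h' <;> omega

/-- **`η(5,3) ≤ 28 = σ(5,3)`** (`HypRootLawAt 5 3 28`): every real symmetric `5 × 5` lacunary pencil with `3` terms whose
determinant lies in the sector has determinant degree `≤ 28` — ALL supports `d : Fin 3 → ℕ`. [folklore] -/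
theorem hypRootLawAt_five_three_28 : HypRootLawAt 5 3 28 := by
  intro d S hS hsec
  by_contra hdeg'
  have hdeg : 28 < (pencil d S).det.natDegree := not_le.mp hdeg'
  have hq : (pencil d S).det ≠ 0 := by
    intro h0
    rw [h0] at hdeg
    simp at hdeg
  have himage : ∀ r, r ∈ (Finset.univ : Finset (Sym (Fin 3) 5)).image
      (fun s : Sym (Fin 3) 5 => ((s : Multiset (Fin 3)).map d).sum) →
      ∃ s : Multiset (Fin 3), Multiset.card s = 5 ∧ (s.map d).sum = r := by
    intro r hr
    rw [Finset.mem_image] at hr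
    obtain ⟨s, -, hs⟩ := hr
    exact ⟨(s : Multiset (Fin 3)), s.2, hs⟩
  have hsieve : ∀ r, r + 2 ≤ (pencil d S).det.natDegree →
      (∃ s : Multiset (Fin 3), Multiset.card s = 5 ∧ (s.map d).sum = r) ∨
      (∃ s : Multiset (Fin 3), Multiset.card s = 5 ∧ (s.map d).sum = r + 1) := by
    intro r hr
    rcases sieve d S hq hsec hr with h | h
    · exact Or.inl (himage r h)
    · exact Or.inr (himage (r + 1) h)
  have htop := himage _ (natDegree_mem_sumset d S hq)
  obtain ⟨a, ha⟩ : ∃ a, d a = 0 := by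
    rcases hsieve 0 (by omega) with ⟨s, hsc, hs⟩ | ⟨s, hsc, hs⟩
    · exact exists_eq_zero_of_sum_le_one d s (by omega) (by omega)
    · exact exists_eq_zero_of_sum_le_one d s (by omega) (by omega)
  obtain ⟨x, y, hxy⟩ := values_fin_three_zero d a ha
  have hIn : ∀ r, (∃ s : Multiset (Fin 3), Multiset.card s = 5 ∧ (s.map d).sum = r) →
      (∃ q s : ℕ, q + s ≤ 5 ∧ q * x + s * y = r) := by
    rintro r ⟨s, hsc, hs⟩
    obtain ⟨q, t, hqt, hsum⟩ := sum_eq_stamps_zero d x y hxy s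
    exact ⟨q, t, by omega, by omega⟩
  have hdeg2 : 29 ≤ (Matrix.det (∑ l, ((Polynomial.X : ℝ[X]) ^ d l) • (S l).map Polynomial.C)).natDegree := hdeg
  exact chain53 x y _ hdeg2 (hIn _ htop) (fun r hr => (hsieve r hr).imp (hIn r) (hIn (r + 1)))

/-! ## The lower sides by name and the exact rows -/

/-- **`η(4,3) ≥ 20`**: `¬ HypRootLawAt 4 3 19` — the doubled F5 realisation (`fullyRealisable_four_013_ten`). [folklore] -/
theorem not_hypRootLawAt_four_three_19 : ¬ HypRootLawAt 4 3 19 :=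
  not_hypRootLawAt_of_fullyRealisable fullyRealisable_four_013_ten (by norm_num)

/-- **`η(5,3) ≥ 28`**: `¬ HypRootLawAt 5 3 27` — the doubled `(5,3)` realisation (`fullyRealisable_five_014_fourteen`). [folklore] -/
theorem not_hypRootLawAt_five_three_27 : ¬ HypRootLawAt 5 3 27 :=
  not_hypRootLawAt_of_fullyRealisable fullyRealisable_five_014_fourteen (by norm_num)

/-- **`η(4,3) = 20` EXACT on both sides.** [folklore] -/
theorem eta_four_three_exact : HypRootLawAt 4 3 20 ∧ ¬ HypRootLawAt 4 3 19 :=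
  ⟨hypRootLawAt_four_three_20, not_hypRootLawAt_four_three_19⟩

/-- **`η(5,3) = 28` EXACT on both sides.** [folklore] -/
theorem eta_five_three_exact : HypRootLawAt 5 3 28 ∧ ¬ HypRootLawAt 5 3 27 :=
  ⟨hypRootLawAt_five_three_28, not_hypRootLawAt_five_three_27⟩

end Summit.ValiantsHypothesis.ValiantsHypothesis.Theorems.LacunarySymmetroidMatrixDescartes.FiniteSector
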